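import Mathlib
import HarnessLib

/-!
# The action of `Sp₄(ℝ)` on the Siegel upper half space of degree 2, in coordinates

Stage 2a of the bottom-up proof of Siegel's volume formula
`Literature.NumberTheory.ModularForms.Siegel1943_vol_F2` (`vol(F₂) = π³/270`; [cite: Klingen1990,
Ch. I §3, closing remark]). The fact is stated on `ℝ⁶` with coordinates
`x = (x₁₁, x₁₂, x₂₂, y₁₁, y₁₂, y₂₂) : Fin 6 → ℝ`; accordingly we realise the Siegel upper half space
`H₂ = {Z = X + iY ∈ Sym₂(ℂ) : Y > 0}` as the open set
`Sp4Covolume.U = {x | 0 < x₃ ∧ x₄² < x₃ x₅} ⊂ ℝ⁶` and transport the classical action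
`Z ↦ g⟨Z⟩ = (AZ + B)(CZ + D)⁻¹` of `g = (A B; C D) ∈ Sp₄(ℝ)` (Mathlib's
`Matrix.symplecticGroup (Fin 2) ℝ`, block form `fromBlocks A B C D` with the relations
`AᵀC = CᵀA`, `BᵀD = DᵀB`, `AᵀD - CᵀB = 1`, `Matrix.SymplecticGroup.fromBlocks_mem_iff`) to it
(`Sp4Covolume.smulVec`, via `toZ : ℝ⁶ → Sym₂(ℂ)` and `ofZ`).

Everything is PROVED (no named facts), following Klingen, Ch. I §1 (proof of Prop. 1 and (4)–(6)):

* `matP_transpose_mul_matQ`, `matP_transpose_mul_conj_matQ` — for `P = AZ + B`, `Q = CZ + D`: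
  `PᵀQ = QᵀP` and `PᵀQ̄ - QᵀP̄ = Z - Z̄ = 2iY` (the identities behind Klingen's (4)).
* `det_matQ_ne_zero` — **`det(CZ + D) ≠ 0` on `H₂`** (if `Qv = 0` then `vᵀ Y v̄ = 0`, so `v = 0`).
* `smulZ_transpose` — `g⟨Z⟩` is symmetric; `im_quad_smulZ_pos`, `smulVec_mem_U` — its imaginary
  part is positive definite (`Im(uᵀ g⟨Z⟩ u) = tᵀ Y t̄` with `t = Q⁻¹u`), i.e. **`g⟨Z⟩ ∈ H₂`**.
* `detY_smulVec` — **the height transforms as `det Y(g⟨Z⟩) = det Y / |det(CZ + D)|²`**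
  (Klingen (6)), from `Qᵀ (g⟨Z⟩ - conj g⟨Z⟩) Q̄ = 2iY`.
* `smulZ_mul`, `smulVec_mul`, `smulVec_one` — the action laws `(gh)⟨Z⟩ = g⟨h⟨Z⟩⟩` together with
  the cocycle `Q_{gh}(Z) = Q_g(h⟨Z⟩) Q_h(Z)` (through `g · (Z; 1) = (g⟨Z⟩; 1) · Q`), assembled into
  a `MulAction (Matrix.symplecticGroup (Fin 2) ℝ) ↥U`.

Later stages use this for the `Sp₄(ℤ)`-invariance of the symplectic volume `dx dy / det y³` and of
the theta function `θ_Z` of `SiegelThetaGenusTwo.lean`, and for the fundamental-domain property of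
`siegelFundamentalDomainTwo`.

## References

* H. Klingen, *Introductory Lectures on Siegel Modular Forms*, CUP 1990, Ch. I §1, Prop. 1 and
  (1)–(6). [Klingen1990]
-/

noncomputable section

namespace Literature.NumberTheory.ModularForms.Sp4Covolume

open Complex Matrix

/-- `Sp₄(ℝ)` (Mathlib's symplectic group in `2 × 2` block form). [folklore] -/
abbrev Sp4R := Matrix.symplecticGroup (Fin 2) ℝ

variable (g : Sp4R)

/-- Blocks of `g = (A B; C D)`. [folklore] -/
def blkA : Matrix (Fin 2) (Fin 2) ℝ := (g : Matrix (Fin 2 ⊕ Fin 2) (Fin 2 ⊕ Fin 2) ℝ).toBlocks₁₁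
/-- The block `B` of `g = (A B; C D)`. [folklore] -/
def blkB : Matrix (Fin 2) (Fin 2) ℝ := (g : Matrix (Fin 2 ⊕ Fin 2) (Fin 2 ⊕ Fin 2) ℝ).toBlocks₁₂
/-- The block `C` of `g = (A B; C D)`. [folklore] -/
def blkC : Matrix (Fin 2) (Fin 2) ℝ := (g : Matrix (Fin 2 ⊕ Fin 2) (Fin 2 ⊕ Fin 2) ℝ).toBlocks₂₁
/-- The block `D` of `g = (A B; C D)`. [folklore] -/
def blkD : Matrix (Fin 2) (Fin 2) ℝ := (g : Matrix (Fin 2 ⊕ Fin 2) (Fin 2 ⊕ Fin 2) ℝ).toBlocks₂₂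

/-- `g` is the block matrix of its blocks. [folklore] -/
theorem fromBlocks_blk : fromBlocks (blkA g) (blkB g) (blkC g) (blkD g) = g :=
  fromBlocks_toBlocks _

/-- The symplectic relations `AᵀC = CᵀA`, `BᵀD = DᵀB`, `AᵀD - CᵀB = 1`.
[cite: Klingen1990, Ch. I §1 (1)] -/
theorem blk_rel :
    (blkA g)ᵀ * blkC g = (blkC g)ᵀ * blkA g ∧ (blkB g)ᵀ * blkD g = (blkD g)ᵀ * blkB g ∧
      (blkA g)ᵀ * blkD g - (blkC g)ᵀ * blkB g = 1 := by
  have h : fromBlocks (blkA g) (blkB g) (blkC g) (blkD g) ∈ Matrix.symplecticGroup (Fin 2) ℝ := by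
    rw [fromBlocks_blk]; exact g.2
  exact SymplecticGroup.fromBlocks_mem_iff.1 h

/-- Complexified blocks. [folklore] -/
def cA : Matrix (Fin 2) (Fin 2) ℂ := (blkA g).map ((↑) : ℝ → ℂ)
/-- The block `B` as a complex matrix. [folklore] -/
def cB : Matrix (Fin 2) (Fin 2) ℂ := (blkB g).map ((↑) : ℝ → ℂ)
/-- The block `C` as a complex matrix. [folklore] -/
def cC : Matrix (Fin 2) (Fin 2) ℂ := (blkC g).map ((↑) : ℝ → ℂ)
/-- The block `D` as a complex matrix. [folklore] -/
def cD : Matrix (Fin 2) (Fin 2) ℂ := (blkD g).map ((↑) : ℝ → ℂ)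

/-- `Matrix.map` along `ℝ → ℂ` is `map` along `Complex.ofRealHom`. [folklore] -/
theorem map_ofReal_eq {m n : Type*} (M : Matrix m n ℝ) :
    M.map ((↑) : ℝ → ℂ) = M.map Complex.ofRealHom := rfl

/-- The symplectic relations for the complexified blocks. [cite: Klingen1990, Ch. I §1 (1)] -/
theorem c_rel :
    (cA g)ᵀ * cC g = (cC g)ᵀ * cA g ∧ (cB g)ᵀ * cD g = (cD g)ᵀ * cB g ∧
      (cA g)ᵀ * cD g - (cC g)ᵀ * cB g = 1 := by
  obtain ⟨h1, h2, h3⟩ := blk_rel g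
  refine ⟨?_, ?_, ?_⟩
  · have := congrArg (fun M : Matrix (Fin 2) (Fin 2) ℝ => M.map Complex.ofRealHom) h1
    simpa [Matrix.map_mul, Matrix.transpose_map, cA, cC, map_ofReal_eq] using this
  · have := congrArg (fun M : Matrix (Fin 2) (Fin 2) ℝ => M.map Complex.ofRealHom) h2
    simpa [Matrix.map_mul, Matrix.transpose_map, cB, cD, map_ofReal_eq] using this
  · have := congrArg (fun M : Matrix (Fin 2) (Fin 2) ℝ => M.map Complex.ofRealHom) h3
    simpa [Matrix.map_mul, Matrix.map_sub, Matrix.transpose_map, cA, cB, cC, cD, map_ofReal_eq,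
      Matrix.map_one] using this

/-- Transposed forms of the relations: `DᵀA - BᵀC = 1`. [folklore] -/
theorem c_rel' : (cD g)ᵀ * cA g - (cB g)ᵀ * cC g = 1 := by
  have h := congrArg transpose (c_rel g).2.2
  simpa [transpose_sub, transpose_mul] using h

/-- Conjugation fixes the (real) blocks. [folklore] -/
theorem conj_cA : (cA g).map (starRingEnd ℂ) = cA g := by
  ext i j; simp [cA]
/-- Conjugation fixes `B`. [folklore] -/
theorem conj_cB : (cB g).map (starRingEnd ℂ) = cB g := by
  ext i j; simp [cB]
/-- Conjugation fixes `C`. [folklore] -/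
theorem conj_cC : (cC g).map (starRingEnd ℂ) = cC g := by
  ext i j; simp [cC]
/-- Conjugation fixes `D`. [folklore] -/
theorem conj_cD : (cD g).map (starRingEnd ℂ) = cD g := by
  ext i j; simp [cD]

variable (x : Fin 6 → ℝ)

/-- `Z = X + iY` as a complex symmetric matrix. [folklore] -/
def toZ : Matrix (Fin 2) (Fin 2) ℂ :=
  !![(x 0 : ℂ) + x 3 * I, (x 1 : ℂ) + x 4 * I; (x 1 : ℂ) + x 4 * I, (x 2 : ℂ) + x 5 * I]

/-- `Y` as a complex matrix. [folklore] -/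
def toYc : Matrix (Fin 2) (Fin 2) ℂ := !![(x 3 : ℂ), x 4; x 4, x 5]

/-- `Z` is symmetric. [folklore] -/
theorem toZ_transpose : (toZ x)ᵀ = toZ x := by
  ext i j; fin_cases i <;> fin_cases j <;> rfl

/-- `Z - Z̄ = 2iY`. [folklore] -/
theorem toZ_sub_conj : toZ x - (toZ x).map (starRingEnd ℂ) = (2 * I) • toYc x := by
  ext i j
  fin_cases i <;> fin_cases j <;>
    simp [toZ, toYc, Complex.ext_iff] <;> ring

/-- `P = AZ + B`, `Q = CZ + D`. [folklore] -/
def matP : Matrix (Fin 2) (Fin 2) ℂ := cA g * toZ x + cB g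
/-- `Q = CZ + D`. [folklore] -/
def matQ : Matrix (Fin 2) (Fin 2) ℂ := cC g * toZ x + cD g

/-- `PᵀQ = QᵀP`. [folklore] -/
theorem matP_transpose_mul_matQ : (matP g x)ᵀ * matQ g x = (matQ g x)ᵀ * matP g x := by
  obtain ⟨h1, h2, h3⟩ := c_rel g
  have h3' := c_rel' g
  have key : (matP g x)ᵀ * matQ g x - (matQ g x)ᵀ * matP g x =
      toZ x * ((cA g)ᵀ * cC g - (cC g)ᵀ * cA g) * toZ x + toZ x * ((cA g)ᵀ * cD g - (cC g)ᵀ * cB g) -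
        ((cD g)ᵀ * cA g - (cB g)ᵀ * cC g) * toZ x + ((cB g)ᵀ * cD g - (cD g)ᵀ * cB g) := by
    simp only [matP, matQ, transpose_add, transpose_mul, toZ_transpose]
    noncomm_ring
  rw [h1, h3, h3', h2, sub_self, sub_self] at key
  rw [← sub_eq_zero, key]
  noncomm_ring

/-- `PᵀQ̄ - QᵀP̄ = Z - Z̄ = 2iY`. [folklore] -/
theorem matP_transpose_mul_conj_matQ :
    (matP g x)ᵀ * (matQ g x).map (starRingEnd ℂ) - (matQ g x)ᵀ * (matP g x).map (starRingEnd ℂ) =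
      (2 * I) • toYc x := by
  obtain ⟨h1, h2, h3⟩ := c_rel g
  have h3' := c_rel' g
  have eP : (matP g x).map (starRingEnd ℂ) = cA g * (toZ x).map (starRingEnd ℂ) + cB g := by
    unfold matP
    rw [Matrix.map_add (starRingEnd ℂ) (map_add (starRingEnd ℂ)), show (cA g * toZ x).map (starRingEnd ℂ) =
      (cA g).map (starRingEnd ℂ) * (toZ x).map (starRingEnd ℂ) from Matrix.map_mul, conj_cA, conj_cB]
  have eQ : (matQ g x).map (starRingEnd ℂ) = cC g * (toZ x).map (starRingEnd ℂ) + cD g := by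
    unfold matQ
    rw [Matrix.map_add (starRingEnd ℂ) (map_add (starRingEnd ℂ)), show (cC g * toZ x).map (starRingEnd ℂ) =
      (cC g).map (starRingEnd ℂ) * (toZ x).map (starRingEnd ℂ) from Matrix.map_mul, conj_cC, conj_cD]
  have key : (matP g x)ᵀ * (matQ g x).map (starRingEnd ℂ) - (matQ g x)ᵀ * (matP g x).map (starRingEnd ℂ) =
      toZ x * ((cA g)ᵀ * cC g - (cC g)ᵀ * cA g) * (toZ x).map (starRingEnd ℂ) +
        toZ x * ((cA g)ᵀ * cD g - (cC g)ᵀ * cB g) -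
        ((cD g)ᵀ * cA g - (cB g)ᵀ * cC g) * (toZ x).map (starRingEnd ℂ) +
        ((cB g)ᵀ * cD g - (cD g)ᵀ * cB g) := by
    rw [eP, eQ]
    simp only [matP, matQ, transpose_add, transpose_mul, toZ_transpose]
    noncomm_ring
  rw [key, h1, h3, h3', h2, sub_self, sub_self, ← toZ_sub_conj]
  noncomm_ring

/-! ### The Siegel upper half space in coordinates and invertibility of `CZ + D` -/

/-- `H₂` in coordinates: `Y > 0`. [folklore] -/
def U : Set (Fin 6 → ℝ) := {x | 0 < x 3 ∧ x 4 ^ 2 < x 3 * x 5}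

variable {x}

/-- `Y[u] ≥ 0` on `H₂`. [folklore] -/
theorem yquad_nonneg (hx : x ∈ U) (p q : ℝ) : 0 ≤ x 3 * p ^ 2 + 2 * x 4 * p * q + x 5 * q ^ 2 := by
  obtain ⟨h3, hdet⟩ := hx
  have key : x 3 * (x 3 * p ^ 2 + 2 * x 4 * p * q + x 5 * q ^ 2) =
      (x 3 * p + x 4 * q) ^ 2 + (x 3 * x 5 - x 4 ^ 2) * q ^ 2 := by ring
  have : 0 ≤ x 3 * (x 3 * p ^ 2 + 2 * x 4 * p * q + x 5 * q ^ 2) := by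
    rw [key]; nlinarith [sq_nonneg (x 3 * p + x 4 * q), sq_nonneg q]
  exact (mul_nonneg_iff_of_pos_left h3).1 this

/-- `Y[u] > 0` for `u ≠ 0` on `H₂`. [folklore] -/
theorem yquad_pos (hx : x ∈ U) {p q : ℝ} (h : p ≠ 0 ∨ q ≠ 0) :
    0 < x 3 * p ^ 2 + 2 * x 4 * p * q + x 5 * q ^ 2 := by
  obtain ⟨h3, hdet⟩ := hx
  have key : x 3 * (x 3 * p ^ 2 + 2 * x 4 * p * q + x 5 * q ^ 2) =
      (x 3 * p + x 4 * q) ^ 2 + (x 3 * x 5 - x 4 ^ 2) * q ^ 2 := by ring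
  have hD : 0 < x 3 * x 5 - x 4 ^ 2 := by linarith
  suffices 0 < x 3 * (x 3 * p ^ 2 + 2 * x 4 * p * q + x 5 * q ^ 2) from
    pos_of_mul_pos_right this h3.le
  rw [key]
  rcases h with hp | hq
  · by_cases hq : q = 0
    · subst hq
      have : x 3 * p ≠ 0 := mul_ne_zero h3.ne' hp
      have hsq : 0 < (x 3 * p) ^ 2 := by positivity
      nlinarith
    · have : 0 < q ^ 2 := by positivity
      nlinarith [sq_nonneg (x 3 * p + x 4 * q)]
  · have : 0 < q ^ 2 := by positivity
    nlinarith [sq_nonneg (x 3 * p + x 4 * q)]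

/-- `vᵀ Y v̄` in coordinates: real part. [folklore] -/
theorem re_dot_toYc_star (x : Fin 6 → ℝ) (v : Fin 2 → ℂ) :
    (v ⬝ᵥ (toYc x *ᵥ star v)).re =
      x 3 * ((v 0).re ^ 2 + (v 0).im ^ 2) +
        2 * x 4 * ((v 0).re * (v 1).re + (v 0).im * (v 1).im) +
        x 5 * ((v 1).re ^ 2 + (v 1).im ^ 2) := by
  simp [toYc, Matrix.mulVec, dotProduct, Fin.sum_univ_two, Complex.mul_re]
  ring

/-- Positivity of `vᵀ Y v̄` for `v ≠ 0`. [folklore] -/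
theorem dot_toYc_star_ne_zero (hx : x ∈ U) {v : Fin 2 → ℂ} (hv : v ≠ 0) :
    v ⬝ᵥ (toYc x *ᵥ star v) ≠ 0 := by
  intro hzero0
  have hzero := congrArg Complex.re hzero0
  rw [re_dot_toYc_star, Complex.zero_re] at hzero
  have hsum : 0 ≤ x 3 * (v 0).re ^ 2 + 2 * x 4 * (v 0).re * (v 1).re + x 5 * (v 1).re ^ 2 :=
    yquad_nonneg hx _ _
  have hsum' : 0 ≤ x 3 * (v 0).im ^ 2 + 2 * x 4 * (v 0).im * (v 1).im + x 5 * (v 1).im ^ 2 :=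
    yquad_nonneg hx _ _
  -- some component of v is nonzero
  have hcomp : (v 0).re ≠ 0 ∨ (v 1).re ≠ 0 ∨ (v 0).im ≠ 0 ∨ (v 1).im ≠ 0 := by
    by_contra h
    push Not at h
    obtain ⟨h1, h2, h3, h4⟩ := h
    apply hv
    ext i
    fin_cases i
    · exact Complex.ext (by simpa using h1) (by simpa using h3)
    · exact Complex.ext (by simpa using h2) (by simpa using h4)
  have e : x 3 * ((v 0).re ^ 2 + (v 0).im ^ 2) +
      2 * x 4 * ((v 0).re * (v 1).re + (v 0).im * (v 1).im) + x 5 * ((v 1).re ^ 2 + (v 1).im ^ 2) =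
      (x 3 * (v 0).re ^ 2 + 2 * x 4 * (v 0).re * (v 1).re + x 5 * (v 1).re ^ 2) +
      (x 3 * (v 0).im ^ 2 + 2 * x 4 * (v 0).im * (v 1).im + x 5 * (v 1).im ^ 2) := by ring
  rw [e] at hzero
  rcases hcomp with h | h | h | h
  · have := yquad_pos hx (p := (v 0).re) (q := (v 1).re) (Or.inl h); linarith
  · have := yquad_pos hx (p := (v 0).re) (q := (v 1).re) (Or.inr h); linarith
  · have := yquad_pos hx (p := (v 0).im) (q := (v 1).im) (Or.inl h); linarith
  · have := yquad_pos hx (p := (v 0).im) (q := (v 1).im) (Or.inr h); linarith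

/-- Conjugating `M *ᵥ v`. [folklore] -/
theorem map_conj_mulVec_star (M : Matrix (Fin 2) (Fin 2) ℂ) (v : Fin 2 → ℂ) :
    M.map (starRingEnd ℂ) *ᵥ star v = star (M *ᵥ v) := by
  ext i
  fin_cases i <;> simp [Matrix.mulVec, dotProduct, Fin.sum_univ_two]

/-- **`det(CZ + D) ≠ 0` on `H₂`** (Klingen I.1: from `PᵀQ̄ - QᵀP̄ = 2iY` and `Y > 0`). [folklore] -/
theorem det_matQ_ne_zero (hx : x ∈ U) : (matQ g x).det ≠ 0 := by
  intro hdet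
  obtain ⟨v, hv, hQv⟩ := Matrix.exists_mulVec_eq_zero_iff.2 hdet
  have key := congrArg (fun M : Matrix (Fin 2) (Fin 2) ℂ => v ⬝ᵥ (M *ᵥ star v))
    (matP_transpose_mul_conj_matQ g x)
  have t1 : (matQ g x).map (starRingEnd ℂ) *ᵥ star v = 0 := by
    rw [map_conj_mulVec_star, hQv, star_zero]
  have t2 : ∀ w : Fin 2 → ℂ, v ⬝ᵥ ((matQ g x)ᵀ *ᵥ w) = 0 := fun w => by
    rw [Matrix.dotProduct_mulVec, Matrix.vecMul_transpose, hQv, zero_dotProduct]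
  rw [Matrix.sub_mulVec, dotProduct_sub, ← Matrix.mulVec_mulVec, ← Matrix.mulVec_mulVec, t1,
    Matrix.mulVec_zero, dotProduct_zero, t2, sub_zero, Matrix.smul_mulVec, dotProduct_smul,
    smul_eq_mul] at key
  have h2 := dot_toYc_star_ne_zero hx hv
  rcases mul_eq_zero.1 key.symm with h | h
  · exact (mul_ne_zero two_ne_zero Complex.I_ne_zero) h
  · exact h2 h

/-- `det(CZ + D)` is a unit on `H₂`. [cite: Klingen1990, Ch. I §1 Prop. 1] -/
theorem isUnit_det_matQ (hx : x ∈ U) : IsUnit (matQ g x).det :=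
  isUnit_iff_ne_zero.2 (det_matQ_ne_zero g hx)

/-! ### The action `Z ↦ (AZ + B)(CZ + D)⁻¹` -/

/-- `g⟨Z⟩ = (AZ + B)(CZ + D)⁻¹` as a complex matrix (junk off `H₂`). [folklore] -/
def smulZ (x : Fin 6 → ℝ) : Matrix (Fin 2) (Fin 2) ℂ := matP g x * (matQ g x)⁻¹

/-- `Q Q⁻¹ = 1` on `H₂`. [folklore] -/
theorem matQ_mul_inv (hx : x ∈ U) : matQ g x * (matQ g x)⁻¹ = 1 :=
  Matrix.mul_nonsing_inv _ (isUnit_det_matQ g hx)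

/-- `Q⁻¹ Q = 1` on `H₂`. [folklore] -/
theorem inv_mul_matQ (hx : x ∈ U) : (matQ g x)⁻¹ * matQ g x = 1 :=
  Matrix.nonsing_inv_mul _ (isUnit_det_matQ g hx)

/-- `g⟨Z⟩ Q = P`. [folklore] -/
theorem smulZ_mul_matQ (hx : x ∈ U) : smulZ g x * matQ g x = matP g x := by
  rw [smulZ, Matrix.mul_assoc, inv_mul_matQ g hx, Matrix.mul_one]

/-- `g⟨Z⟩ = Qᵀ⁻¹ Pᵀ`. [folklore] -/
theorem smulZ_eq_transpose_form (hx : x ∈ U) : smulZ g x = ((matQ g x)ᵀ)⁻¹ * (matP g x)ᵀ := by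
  have hu : IsUnit ((matQ g x)ᵀ).det := by rw [det_transpose]; exact isUnit_det_matQ g hx
  have h1 : ((matQ g x)ᵀ)⁻¹ * (matQ g x)ᵀ = 1 := Matrix.nonsing_inv_mul _ hu
  calc smulZ g x = ((matQ g x)ᵀ)⁻¹ * (matQ g x)ᵀ * (matP g x * (matQ g x)⁻¹) := by
        rw [h1, Matrix.one_mul]; rfl
    _ = ((matQ g x)ᵀ)⁻¹ * ((matQ g x)ᵀ * matP g x) * (matQ g x)⁻¹ := by
        simp only [Matrix.mul_assoc]
    _ = ((matQ g x)ᵀ)⁻¹ * ((matP g x)ᵀ * matQ g x) * (matQ g x)⁻¹ := by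
        rw [matP_transpose_mul_matQ]
    _ = ((matQ g x)ᵀ)⁻¹ * (matP g x)ᵀ := by
        rw [Matrix.mul_assoc, Matrix.mul_assoc, matQ_mul_inv g hx, Matrix.mul_one]

/-- **`g⟨Z⟩` is symmetric.** [folklore] -/
theorem smulZ_transpose (hx : x ∈ U) : (smulZ g x)ᵀ = smulZ g x := by
  conv_rhs => rw [smulZ_eq_transpose_form g hx]
  rw [smulZ, transpose_mul, transpose_nonsing_inv]

/-- Reading off coordinates from a (symmetric) complex matrix. [folklore] -/
def ofZ (W : Matrix (Fin 2) (Fin 2) ℂ) : Fin 6 → ℝ :=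
  ![(W 0 0).re, (W 0 1).re, (W 1 1).re, (W 0 0).im, (W 0 1).im, (W 1 1).im]

/-- `ofZ ∘ toZ = id`. [folklore] -/
theorem ofZ_toZ (x : Fin 6 → ℝ) : ofZ (toZ x) = x := by
  ext i
  fin_cases i <;> simp [ofZ, toZ]

/-- `toZ ∘ ofZ = id` on symmetric matrices. [folklore] -/
theorem toZ_ofZ {W : Matrix (Fin 2) (Fin 2) ℂ} (hW : Wᵀ = W) : toZ (ofZ W) = W := by
  have h10 : W 1 0 = W 0 1 := by
    have := congrFun (congrFun hW 0) 1
    simpa using this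
  ext i j
  fin_cases i <;> fin_cases j <;>
    simp [ofZ, toZ, h10]

/-- The action in coordinates. [folklore] -/
def smulVec (x : Fin 6 → ℝ) : Fin 6 → ℝ := ofZ (smulZ g x)

/-- The matrix of `g • x` is `g⟨Z⟩`. [folklore] -/
theorem toZ_smulVec (hx : x ∈ U) : toZ (smulVec g x) = smulZ g x :=
  toZ_ofZ (smulZ_transpose g hx)

/-! ### Positivity of the imaginary part of `g⟨Z⟩` -/

/-- For real `u`, `Im (uᵀ W u) = uᵀ (Im W) u` and for `W = g⟨Z⟩` this equals `tᵀ Y t̄` with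
`t = Q⁻¹ u`; hence it is positive for `u ≠ 0`. [folklore] -/
theorem im_quad_smulZ_pos (hx : x ∈ U) {u : Fin 2 → ℝ} (hu : u ≠ 0) :
    0 < ((fun i => (u i : ℂ)) ⬝ᵥ (smulZ g x *ᵥ fun i => (u i : ℂ))).im := by
  set uc : Fin 2 → ℂ := fun i => (u i : ℂ) with huc
  set t : Fin 2 → ℂ := (matQ g x)⁻¹ *ᵥ uc with ht
  have hQt : matQ g x *ᵥ t = uc := by
    rw [ht, Matrix.mulVec_mulVec, matQ_mul_inv g hx, Matrix.one_mulVec]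
  have hstar_uc : star uc = uc := by
    ext i; simp [huc]
  have ht0 : t ≠ 0 := by
    intro h0
    apply hu
    have : uc = 0 := by rw [← hQt, h0, Matrix.mulVec_zero]
    ext i
    have := congrFun this i
    simpa [huc] using this
  -- s = (P t) ⬝ uc = uᵀ W u
  have hs : uc ⬝ᵥ (smulZ g x *ᵥ uc) = (matP g x *ᵥ t) ⬝ᵥ uc := by
    rw [smulZ, ← Matrix.mulVec_mulVec, ← ht, dotProduct_comm]
  -- sandwich (I2) with t
  have key := congrArg (fun M : Matrix (Fin 2) (Fin 2) ℂ => t ⬝ᵥ (M *ᵥ star t))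
    (matP_transpose_mul_conj_matQ g x)
  rw [Matrix.sub_mulVec, dotProduct_sub, ← Matrix.mulVec_mulVec, ← Matrix.mulVec_mulVec,
    map_conj_mulVec_star, map_conj_mulVec_star, hQt, hstar_uc, Matrix.dotProduct_mulVec,
    Matrix.vecMul_transpose, Matrix.dotProduct_mulVec t, Matrix.vecMul_transpose, hQt,
    Matrix.smul_mulVec, dotProduct_smul, smul_eq_mul] at key
  -- key : (P t) ⬝ uc - uc ⬝ star (P t) = 2 I * (t ⬝ (Y ⋆t))
  have hconj : uc ⬝ᵥ star (matP g x *ᵥ t) = (starRingEnd ℂ) ((matP g x *ᵥ t) ⬝ᵥ uc) := by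
    simp [dotProduct, Fin.sum_univ_two, huc, mul_comm]
  rw [hconj, Complex.sub_conj] at key
  -- key : ↑(2 * s.im) * I = 2 * I * τ  ⟹  τ = ↑(s.im)
  have hτ : t ⬝ᵥ (toYc x *ᵥ star t) = (((matP g x *ᵥ t) ⬝ᵥ uc).im : ℂ) := by
    have h2I : (2 * I : ℂ) ≠ 0 := mul_ne_zero two_ne_zero Complex.I_ne_zero
    apply mul_left_cancel₀ h2I
    rw [← key]
    push_cast
    ring
  have hτre := congrArg Complex.re hτ
  rw [Complex.ofReal_re] at hτre
  have hpos : 0 < (t ⬝ᵥ (toYc x *ᵥ star t)).re := by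
    rw [re_dot_toYc_star]
    have hne := dot_toYc_star_ne_zero hx ht0
    have hnn1 := yquad_nonneg hx (t 0).re (t 1).re
    have hnn2 := yquad_nonneg hx (t 0).im (t 1).im
    -- positivity from `dot_toYc_star_ne_zero`-style case analysis
    have hcomp : (t 0).re ≠ 0 ∨ (t 1).re ≠ 0 ∨ (t 0).im ≠ 0 ∨ (t 1).im ≠ 0 := by
      by_contra h
      push Not at h
      obtain ⟨h1, h2, h3, h4⟩ := h
      apply ht0
      ext i
      fin_cases i
      · exact Complex.ext (by simpa using h1) (by simpa using h3)
      · exact Complex.ext (by simpa using h2) (by simpa using h4)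
    have e : x 3 * ((t 0).re ^ 2 + (t 0).im ^ 2) +
        2 * x 4 * ((t 0).re * (t 1).re + (t 0).im * (t 1).im) + x 5 * ((t 1).re ^ 2 + (t 1).im ^ 2) =
        (x 3 * (t 0).re ^ 2 + 2 * x 4 * (t 0).re * (t 1).re + x 5 * (t 1).re ^ 2) +
        (x 3 * (t 0).im ^ 2 + 2 * x 4 * (t 0).im * (t 1).im + x 5 * (t 1).im ^ 2) := by ring
    rw [e]
    rcases hcomp with h | h | h | h
    · have := yquad_pos hx (p := (t 0).re) (q := (t 1).re) (Or.inl h); linarith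
    · have := yquad_pos hx (p := (t 0).re) (q := (t 1).re) (Or.inr h); linarith
    · have := yquad_pos hx (p := (t 0).im) (q := (t 1).im) (Or.inl h); linarith
    · have := yquad_pos hx (p := (t 0).im) (q := (t 1).im) (Or.inr h); linarith
  rw [hs]
  linarith

/-- The imaginary part of `uᵀ g⟨Z⟩ u` (real `u`) as a quadratic form in the new coordinates. [folklore] -/
theorem im_quad_smulZ_eq (hx : x ∈ U) (u : Fin 2 → ℝ) :
    ((fun i => (u i : ℂ)) ⬝ᵥ (smulZ g x *ᵥ fun i => (u i : ℂ))).im =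
      u 0 ^ 2 * smulVec g x 3 + 2 * u 0 * u 1 * smulVec g x 4 + u 1 ^ 2 * smulVec g x 5 := by
  have h10 : smulZ g x 1 0 = smulZ g x 0 1 := by
    have := congrFun (congrFun (smulZ_transpose g hx) 0) 1
    simpa using this
  simp [dotProduct, Matrix.mulVec, Fin.sum_univ_two, smulVec, ofZ, h10, Complex.mul_im]
  ring

/-- **`g⟨Z⟩ ∈ H₂`**: the imaginary part of `g⟨Z⟩` is positive definite. [folklore] -/
theorem smulVec_mem_U (hx : x ∈ U) : smulVec g x ∈ U := by
  have h1 := im_quad_smulZ_pos g hx (u := ![1, 0]) (by simp)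
  rw [im_quad_smulZ_eq g hx] at h1
  simp only [Matrix.cons_val_zero, Matrix.cons_val_one, one_pow, one_mul,
    mul_zero, zero_mul, add_zero, ne_eq, OfNat.ofNat_ne_zero, not_false_eq_true, zero_pow] at h1
  refine ⟨h1, ?_⟩
  have h2 := im_quad_smulZ_pos g hx (u := ![smulVec g x 4, -smulVec g x 3])
    (by intro h; have := congrFun h 1; simp at this; linarith)
  rw [im_quad_smulZ_eq g hx] at h2
  simp only [Matrix.cons_val_zero, Matrix.cons_val_one] at h2
  have e : smulVec g x 4 ^ 2 * smulVec g x 3 + 2 * smulVec g x 4 * -smulVec g x 3 * smulVec g x 4 +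
      (-smulVec g x 3) ^ 2 * smulVec g x 5 =
      smulVec g x 3 * (smulVec g x 3 * smulVec g x 5 - smulVec g x 4 ^ 2) := by ring
  rw [e] at h2
  have := pos_of_mul_pos_right h2 h1.le
  linarith

/-! ### The height: `det Im g⟨Z⟩ = det Y / |det(CZ+D)|²` -/

/-- `Qᵀ (W - W̄) Q̄ = 2iY` for `W = g⟨Z⟩`. [folklore] -/
theorem transpose_matQ_mul_sub_conj (hx : x ∈ U) :
    (matQ g x)ᵀ * (smulZ g x - (smulZ g x).map (starRingEnd ℂ)) * (matQ g x).map (starRingEnd ℂ) =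
      (2 * I) • toYc x := by
  have hu : IsUnit ((matQ g x)ᵀ).det := by rw [det_transpose]; exact isUnit_det_matQ g hx
  have hW : (matQ g x)ᵀ * smulZ g x = (matP g x)ᵀ := by
    rw [smulZ_eq_transpose_form g hx, ← Matrix.mul_assoc, Matrix.mul_nonsing_inv _ hu, Matrix.one_mul]
  have hWbar : (smulZ g x).map (starRingEnd ℂ) * (matQ g x).map (starRingEnd ℂ) =
      (matP g x).map (starRingEnd ℂ) := by
    rw [← Matrix.map_mul, smulZ_mul_matQ g hx]
  rw [Matrix.mul_sub, Matrix.sub_mul, hW, Matrix.mul_assoc (matQ g x)ᵀ, hWbar]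
  exact matP_transpose_mul_conj_matQ g x

/-- `W - W̄ = 2i Im W` entrywise. [folklore] -/
theorem sub_map_conj_eq (W : Matrix (Fin 2) (Fin 2) ℂ) :
    W - W.map (starRingEnd ℂ) = (2 * I) • (W.map Complex.im).map ((↑) : ℝ → ℂ) := by
  ext i j
  simp only [Matrix.sub_apply, Matrix.map_apply, Matrix.smul_apply, smul_eq_mul]
  rw [Complex.sub_conj]; push_cast; ring

/-- `det` commutes with conjugation. [folklore] -/
theorem det_map_conj (M : Matrix (Fin 2) (Fin 2) ℂ) :
    (M.map (starRingEnd ℂ)).det = (starRingEnd ℂ) M.det := by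
  rw [← RingHom.mapMatrix_apply, RingHom.map_det]

/-- `det` commutes with `ℝ → ℂ`. [folklore] -/
theorem det_map_ofReal (M : Matrix (Fin 2) (Fin 2) ℝ) :
    (M.map ((↑) : ℝ → ℂ)).det = (M.det : ℂ) := by
  rw [map_ofReal_eq, ← RingHom.mapMatrix_apply, ← RingHom.map_det]; rfl

/-- **The height transforms by `|det(CZ+D)|⁻²`**:
`det Y(g⟨Z⟩) = det Y / |det(CZ + D)|²`. [folklore] -/
theorem detY_smulVec (hx : x ∈ U) :
    smulVec g x 3 * smulVec g x 5 - smulVec g x 4 ^ 2 =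
      (x 3 * x 5 - x 4 ^ 2) / Complex.normSq (matQ g x).det := by
  have hdet := det_matQ_ne_zero g hx
  have hn : Complex.normSq (matQ g x).det ≠ 0 := by rwa [Ne, Complex.normSq_eq_zero]
  have key := congrArg Matrix.det (transpose_matQ_mul_sub_conj g hx)
  rw [det_mul, det_mul, det_transpose, sub_map_conj_eq, det_smul, det_smul, Fintype.card_fin,
    det_map_conj, det_map_ofReal] at key
  -- 2x2 real determinants
  have h10 : smulZ g x 1 0 = smulZ g x 0 1 := by
    have := congrFun (congrFun (smulZ_transpose g hx) 0) 1
    simpa using this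
  have hdetIm : ((smulZ g x).map Complex.im).det = smulVec g x 3 * smulVec g x 5 - smulVec g x 4 ^ 2 := by
    rw [Matrix.det_fin_two]
    simp only [Matrix.map_apply, smulVec, ofZ, h10, Matrix.cons_val]
    ring
  have hdetY : (toYc x).det = ((x 3 * x 5 - x 4 ^ 2 : ℝ) : ℂ) := by
    rw [toYc, Matrix.det_fin_two_of]; push_cast; ring
  rw [hdetIm, hdetY] at key
  -- key : det Q * ((2I)^2 * ↑(det Im)) * conj(det Q) = (2I)^2 * ↑(det Y)
  apply Complex.ofReal_injective
  have h2I : ((2 * I) ^ 2 : ℂ) ≠ 0 := pow_ne_zero _ (mul_ne_zero two_ne_zero Complex.I_ne_zero)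
  have hconj : (matQ g x).det * (starRingEnd ℂ) (matQ g x).det = (Complex.normSq (matQ g x).det : ℂ) :=
    Complex.mul_conj _
  push_cast at key ⊢
  rw [eq_div_iff (by exact_mod_cast hn), ← hconj]
  apply mul_left_cancel₀ h2I
  linear_combination key

/-! ### Action laws -/

/-- The complexified `4 × 4` matrix of `g`. [folklore] -/
def gc : Matrix (Fin 2 ⊕ Fin 2) (Fin 2 ⊕ Fin 2) ℂ :=
  (g : Matrix (Fin 2 ⊕ Fin 2) (Fin 2 ⊕ Fin 2) ℝ).map ((↑) : ℝ → ℂ)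

/-- The complexified matrix in block form. [folklore] -/
theorem gc_eq_fromBlocks : gc g = fromBlocks (cA g) (cB g) (cC g) (cD g) := by
  unfold gc cA cB cC cD
  conv_lhs => rw [← fromBlocks_blk g]
  exact fromBlocks_map _ _ _ _ _

/-- Complexification is multiplicative. [folklore] -/
theorem gc_mul (h : Sp4R) : gc (g * h) = gc g * gc h := by
  unfold gc
  rw [Submonoid.coe_mul, map_ofReal_eq, map_ofReal_eq, map_ofReal_eq]
  exact Matrix.map_mul

/-- The `4 × 4` matrix `(Z 0; W 0)` (a block column padded by zeros). [folklore] -/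
def blkCol (Z W : Matrix (Fin 2) (Fin 2) ℂ) : Matrix (Fin 2 ⊕ Fin 2) (Fin 2 ⊕ Fin 2) ℂ :=
  fromBlocks Z 0 W 0

/-- `blkCol` is injective. [folklore] -/
theorem blkCol_inj {Z W Z' W' : Matrix (Fin 2) (Fin 2) ℂ} (h : blkCol Z W = blkCol Z' W') :
    Z = Z' ∧ W = W' := by
  obtain ⟨h1, -, h2, -⟩ := Matrix.fromBlocks_inj.1 h
  exact ⟨h1, h2⟩

/-- `g · (Z 0; 1 0) = (P 0; Q 0)`. [folklore] -/
theorem gc_mul_col (x : Fin 6 → ℝ) :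
    gc g * blkCol (toZ x) 1 = blkCol (matP g x) (matQ g x) := by
  rw [gc_eq_fromBlocks, blkCol, blkCol, fromBlocks_multiply]
  simp [matP, matQ]

/-- `(P 0; Q 0) = (W 0; 1 0) (Q 0; 0 0)` on `H₂`. [folklore] -/
theorem col_matP_matQ (hx : x ∈ U) :
    blkCol (matP g x) (matQ g x) = blkCol (smulZ g x) 1 * blkCol (matQ g x) 0 := by
  rw [blkCol, blkCol, blkCol, fromBlocks_multiply, smulZ_mul_matQ g hx]
  simp

/-- Product of two zero-padded columns. [folklore] -/
theorem blkCol_mul_zero (Q Q' : Matrix (Fin 2) (Fin 2) ℂ) :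
    blkCol Q 0 * blkCol Q' 0 = blkCol (Q * Q') 0 := by
  rw [blkCol, blkCol, blkCol, fromBlocks_multiply]
  simp

/-- Right multiplication of a padded column. [folklore] -/
theorem blkCol_mul (Z W Q : Matrix (Fin 2) (Fin 2) ℂ) :
    blkCol Z W * blkCol Q 0 = blkCol (Z * Q) (W * Q) := by
  rw [blkCol, blkCol, blkCol, fromBlocks_multiply]
  simp

/-- **The cocycle/action law on matrices**: `(gh)⟨Z⟩ = g⟨h⟨Z⟩⟩` and `Q_{gh}(Z) = Q_g(hZ) Q_h(Z)`. [folklore] -/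
theorem smulZ_mul (h : Sp4R) (hx : x ∈ U) :
    smulZ (g * h) x = smulZ g (smulVec h x) ∧
      matQ (g * h) x = matQ g (smulVec h x) * matQ h x := by
  have hxh : smulVec h x ∈ U := smulVec_mem_U h hx
  have e1 : gc (g * h) * blkCol (toZ x) 1 = blkCol (matP (g * h) x) (matQ (g * h) x) :=
    gc_mul_col (g * h) x
  have e2 : gc (g * h) * blkCol (toZ x) 1 =
      blkCol (smulZ g (smulVec h x) * (matQ g (smulVec h x) * matQ h x))
        (matQ g (smulVec h x) * matQ h x) := by
    rw [gc_mul, Matrix.mul_assoc, gc_mul_col h x, col_matP_matQ h hx, ← Matrix.mul_assoc,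
      ← toZ_smulVec h hx, gc_mul_col g (smulVec h x), col_matP_matQ g hxh,
      Matrix.mul_assoc, blkCol_mul_zero, blkCol_mul, Matrix.one_mul]
  rw [e1] at e2
  obtain ⟨hP, hQ⟩ := blkCol_inj e2
  refine ⟨?_, hQ⟩
  have hu : IsUnit (matQ (g * h) x).det := isUnit_det_matQ (g * h) hx
  rw [smulZ, hP, ← hQ, Matrix.mul_assoc, Matrix.mul_nonsing_inv _ hu, Matrix.mul_one]

/-- **`(gh) • x = g • (h • x)` on `H₂`.** [cite: Klingen1990, Ch. I §1 Prop. 1] -/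
theorem smulVec_mul (h : Sp4R) (hx : x ∈ U) : smulVec (g * h) x = smulVec g (smulVec h x) := by
  unfold smulVec
  rw [(smulZ_mul g h hx).1]
  rfl

/-- `1 • x = x`. [folklore] -/
theorem smulVec_one (x : Fin 6 → ℝ) : smulVec 1 x = x := by
  have hA : cA 1 = 1 := by
    unfold cA blkA; rw [OneMemClass.coe_one, ← fromBlocks_one, toBlocks_fromBlocks₁₁]; exact Matrix.map_one _ (by simp) (by simp)
  have hB : cB 1 = 0 := by
    unfold cB blkB; rw [OneMemClass.coe_one, ← fromBlocks_one, toBlocks_fromBlocks₁₂]; exact Matrix.map_zero _ (by simp)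
  have hC : cC 1 = 0 := by
    unfold cC blkC; rw [OneMemClass.coe_one, ← fromBlocks_one, toBlocks_fromBlocks₂₁]; exact Matrix.map_zero _ (by simp)
  have hD : cD 1 = 1 := by
    unfold cD blkD; rw [OneMemClass.coe_one, ← fromBlocks_one, toBlocks_fromBlocks₂₂]; exact Matrix.map_one _ (by simp) (by simp)
  unfold smulVec smulZ matP matQ
  rw [hA, hB, hC, hD, Matrix.one_mul, add_zero, Matrix.zero_mul, zero_add, inv_one, Matrix.mul_one,
    ofZ_toZ]

/-- **`Sp₄(ℝ)` acts on `H₂`** (in coordinates). [folklore] -/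
instance instSMulU : SMul Sp4R U := ⟨fun g p => ⟨smulVec g p.1, smulVec_mem_U g p.2⟩⟩

/-- The action on the subtype `↥U` is `smulVec`. [folklore] -/
theorem smul_coe (g : Sp4R) (p : U) : ((g • p : U) : Fin 6 → ℝ) = smulVec g p := rfl

/-- **`Sp₄(ℝ)` acts on `H₂`** (`MulAction` on the subtype). [cite: Klingen1990, Ch. I §1 Prop. 1] -/
instance instMulActionU : MulAction Sp4R U where
  one_smul p := Subtype.ext (smulVec_one p.1)
  mul_smul g h p := Subtype.ext (smulVec_mul g h p.2)

end Literature.NumberTheory.ModularForms.Sp4Covolume
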